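import Summits.NavierStokesRegularity.NavierStokesRegularity.Theses.PalasekTowerBreakdown
import Summits.NavierStokesRegularity.NavierStokesRegularity.Theorems.HeredityAtOne.Negative.HeredityAtOneFalseOfCappedStageAtOne

/-!
# `HeredityAtOneT` / `HeredityFromTwoT` are false modulo a sub-floor competitor — the R-generic template

Refuter seat (refuter4 g9), NEGATIVE LEMMAS MODULO `H` for the PTB rev-19 RE-BASE items
stmt-NavierStokesRegularity-20304 `HeredityAtOneT` (= `HeredityAtGAt TowerRates.tuned 1`) and -20305
`HeredityFromTwoT` (= `HeredityFromGAt TowerRates.tuned 2`) of route `PalasekTowerBreakdown`; `--supports`,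
Negative lane. No Theses decl is concluded positively; no witness of any `H` is constructed.

The sharp sub-floor template of `HeredityAtOneFalseOfCappedStageAtOne` (§1 there, stated on
`TowerRates.wide`) is REGISTER-GENERIC: for every rates record `R` and every level `k`,
`H_sub(R, k) → ¬ HeredityAtGAt R k` (`not_heredityAtGAt_of_subfloorStageGAt`), where `H_sub(R, k)` =
`SubfloorStageGAt R k` says that some pinned (`Λ = 8`, `θ = 6/5`) rigid quiet design on `R` carries a
registered (`Margins.routeG R`) level-`k` stage AND a finite-energy classical competitor from the same datum
whose speed at `τ_{k+1}` is below the floor `c₁ Y_{k+1}` on the readout ball — forced Serrin–Masuda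
uniqueness (`Stage.velocity_eq_of_window_ceiling`) identifies the competitor with the extension stage, whose
floor it then violates. At `R = wide` this is the file of record verbatim (`subfloorStageGAt_wide_iff`);
at `R = tuned` it gives `HeredityAtOneT_false_of_SubfloorStageAtOneT` (`H` = `SubfloorStageAtOneT`, the one
named hypothesis of this file) and `HeredityFromTwoT_false_of_subfloorStageGAt` (`H` inline, any level `≥ 2`). READING: the re-base to `TowerRates.tuned` changes the
numbers of the four faces, not the ∀-over-designs exposure of the heredity items — any ONE registered tuned
design with a sub-floor (e.g. capped, swirl-free, small-data) continuation refutes 20304 (resp. 20305); the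
construction of such an `H` is OPEN (it contains a registered level-`k` stage at tuned, the ∃-content of
`EpisodeBaseT` restricted to the class), exactly as at wide.

References: [cite: Palasek2026ElementaryModel, §4]; [cite: Sohr2001, Ch. V Thm. 1.5.1].
-/

noncomputable section

namespace Summit.NavierStokesRegularity.HeredityAtOneTSubfloor

open Set MeasureTheory
open scoped ENNReal NNReal
open Literature.Analysis.FluidPDE
open Summit.NavierStokesRegularity.FluidComputer.PalasekTowerClayBridge
open Summit.NavierStokesRegularity.NavierStokesRegularity

/-! ## §1 The template at arbitrary rates -/

/-- **Witness class `H_sub(R, k)`** (hypothesis, never asserted): some pinned rigid quiet design on the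
rates `R` carries a registered stage at level `k` AND a finite-energy classical solution of its forced system
on `[0, τ_{k+1}]` from the design's datum whose speed at `τ_{k+1}` is below the floor `c₁ Y_{k+1}`
throughout the readout ball. At `R = wide`: `HeredityAtOneSpeedCap.SubfloorStageAt k`.
[cite: Palasek2026ElementaryModel, §4] -/
@[conjecture] def SubfloorStageGAt (R : TowerRates) (k : ℕ) : Prop :=
  ∃ (S : Schedule R) (u : ℝ → EuclideanSpace ℝ (Fin 3) → EuclideanSpace ℝ (Fin 3))
    (p : ℝ → EuclideanSpace ℝ (Fin 3) → ℝ),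
    S.Pins 8 (6 / 5) ∧ S.Rigid ∧ S.Quiet ∧
    Nonempty (Stage 1 R S (Margins.routeG R) k) ∧
    IsClassicalNSSolutionOn (Icc 0 (S.τ (k + 1))) 1 S.f u p ∧ u 0 = S.u₀ ∧
    (∃ C : ℝ≥0∞, C < ⊤ ∧ ∀ t ∈ Icc 0 (S.τ (k + 1)), ∫⁻ x, ‖u t x‖ₑ ^ 2 ≤ C) ∧
    ∀ x, ‖x‖ ≤ S.radius → ‖u (S.τ (k + 1)) x‖ < S.c₁ * R.Y (k + 1)

/-- At `R = wide` the generic witness class is the one of record, definitionally. [folklore] -/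
theorem subfloorStageGAt_wide_iff (k : ℕ) :
    SubfloorStageGAt TowerRates.wide k ↔ HeredityAtOneSpeedCap.SubfloorStageAt k := Iff.rfl

/-- **Sharp refutation template at arbitrary rates**: `H_sub(R, k) → ¬ HeredityAtGAt R k`. The extension
stage given by heredity is a bounded finite-energy classical solution from the same datum, so the competitor
coincides with it on `[0, τ_{k+1}]` (forced Serrin–Masuda, `Stage.velocity_eq_of_window_ceiling`), and the
stage's floor `c₁ Y_{k+1} ≤ ‖u(τ_{k+1}, x)‖` at some `‖x‖ ≤ radius` contradicts the sub-floor readout.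
[cite: Sohr2001, Ch. V Thm. 1.5.1] -/
theorem not_heredityAtGAt_of_subfloorStageGAt {R : TowerRates} {k : ℕ} (hW : SubfloorStageGAt R k) :
    ¬ HeredityAtGAt R k := by
  intro h
  obtain ⟨S, u, p, hP, hR, hQ, ⟨s⟩, hcl, hu0, hE, hsub⟩ := hW
  obtain ⟨s', -⟩ := h S hP hR hQ s
  have hceil' : ∀ t ∈ Icc (S.τ k) (S.τ (k + 1)), ∀ x, ‖s'.u t x‖ ≤ S.c₂ * R.Y (k + 1) :=
    fun t ht x => s'.ceiling (k + 1) le_rfl t ⟨(S.τ_pos k).le.trans ht.1, ht.2⟩ x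
  have heq : ∀ t ∈ Icc 0 (S.τ (k + 1)), u t = s'.u t :=
    s.velocity_eq_of_window_ceiling one_pos s'.classical s'.initial s'.energy hceil' hcl hu0 hE
  obtain ⟨x, hx, hfl⟩ := s'.floor (k + 1) le_rfl
  have h1 := hsub x hx
  rw [heq _ ⟨(S.τ_pos (k + 1)).le, le_rfl⟩] at h1
  exact absurd hfl (not_le.2 h1)

/-- The template against heredity FROM a level: a sub-floor competitor at any level `k ≥ k₀` refutes
`HeredityFromGAt R k₀`. [cite: Sohr2001, Ch. V Thm. 1.5.1] -/
theorem not_heredityFromGAt_of_subfloorStageGAt {R : TowerRates} {k₀ k : ℕ} (hk : k₀ ≤ k)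
    (hW : SubfloorStageGAt R k) : ¬ HeredityFromGAt R k₀ :=
  fun h => not_heredityAtGAt_of_subfloorStageGAt hW (h.heredityAt hk)

/-! ## §2 The re-based items (`TowerRates.tuned`) -/

/-- **`H` for item 20304** (hypothesis, never asserted): a sub-floor competitor beside a registered level-1
stage of some pinned rigid quiet design on the TUNED rates. [cite: Palasek2026ElementaryModel, §4] -/
@[conjecture] def SubfloorStageAtOneT : Prop := SubfloorStageGAt TowerRates.tuned 1

/-- **`HeredityAtOneT` is false modulo `SubfloorStageAtOneT`** (route decl of item 20304).
[cite: Sohr2001, Ch. V Thm. 1.5.1] -/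
theorem HeredityAtOneT_false_of_SubfloorStageAtOneT :
    SubfloorStageAtOneT → ¬ Theses.PalasekTowerBreakdown.HeredityAtOneT :=
  fun hW => not_heredityAtGAt_of_subfloorStageGAt hW

/-- **`HeredityFromTwoT` is false modulo a sub-floor competitor at some level `k ≥ 2` on the tuned rates**
(route decl of item 20305; `H` inline: `∃ k ≥ 2, SubfloorStageGAt tuned k`). [cite: Sohr2001, Ch. V Thm. 1.5.1] -/
theorem HeredityFromTwoT_false_of_subfloorStageGAt {k : ℕ} (hk : 2 ≤ k)
    (hW : SubfloorStageGAt TowerRates.tuned k) : ¬ Theses.PalasekTowerBreakdown.HeredityFromTwoT :=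
  fun h => not_heredityFromGAt_of_subfloorStageGAt hk hW h

/-- A sub-floor competitor at ANY level `k ≥ 1` on the tuned rates refutes the PAIR
`HeredityAtOneT ∧ HeredityFromTwoT` (the pair is heredity from level `1`, `episodeInductionGAt_of_heredity`);
stated as: under `HeredityAtOneT` it refutes `HeredityFromTwoT`. [cite: Sohr2001, Ch. V Thm. 1.5.1] -/
theorem HeredityFromTwoT_false_of_subfloorStageGAt_of_heredityAtOneT {k : ℕ} (hk : 1 ≤ k)
    (hW : SubfloorStageGAt TowerRates.tuned k) (h₁ : Theses.PalasekTowerBreakdown.HeredityAtOneT) :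
    ¬ Theses.PalasekTowerBreakdown.HeredityFromTwoT :=
  fun h₂ => not_heredityFromGAt_of_subfloorStageGAt hk hW (episodeInductionGAt_of_heredity h₁ h₂)

/-- Consistency with the record at `wide`: the generic template gives back item 19249's negative lemma
`heredityAtOne_false_of_subfloorStageAtOne`. [cite: Sohr2001, Ch. V Thm. 1.5.1] -/
theorem HeredityAtOne_false_of_subfloorStageGAt_wide (hW : SubfloorStageGAt TowerRates.wide 1) :
    ¬ Theses.PalasekTowerBreakdown.HeredityAtOne :=
  HeredityAtOneSpeedCap.heredityAtOne_false_of_subfloorStageAtOne ((subfloorStageGAt_wide_iff 1).1 hW)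

end Summit.NavierStokesRegularity.HeredityAtOneTSubfloor

end
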